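import Literature.Barriers.CriticalPhenomena.PlaquetteWalkHoleRootRowOnly
import Literature.Barriers.CriticalPhenomena.PlaquetteWalkHoleRootRowLawWitness
import HarnessLib

/-!
# Barrier catalogue (SAWScalingLimit): a wound class-`B2a` walk of limit cost `5` never returns to a rhombus WEST of the root column
(«NO LEVEL-5 B2a MEMBER WEST OF THE ROOT COLUMN»; the hypothesis `w.1 ≤ r.1` of the root-row theorems discharged)

`Z → ∞` limit model of the printed Yang–Baxter weights [GlazmanManolescu2019, §1, eq. (1)]; the «RECTANGLE COEFFICIENT» line of the venture lane
«pcv-sawmu» (b-engine-1 g28). The structure theorems of the level-`5` coefficient (`ΩG.not_top_row_of_cost_five`, `ΩG.rootRow_of_cost_five`,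
`PlaquetteWalkHoleRootRowOnly`, the ROOT-ROW LAW) carry the hypothesis `w.1 ≤ r.1` — the rooted rhombus lies in the root column or east of it. The
lane's census (kit j276221 / j298353: 3 455 rooted domains, 15 525 cells) finds NO wound member of limit cost `5` at any cell west of the root column
(minimal wound cost `7` off the hole row, `9` on it). This file proves the class-`B2a` half of that observation and removes the hypothesis:

* ★★★ `ΩG.not_top_row_of_cost_five_west`: a wound class-`B2a` walk of limit cost `5` from the hole root `w.side W` at a rhombus `r` with `r.1 < w.1`
  does not have `r` in its top row. CHAIN CALCULUS (`PlaquetteWalkKissChains`) plus ONE parity count on the EASTERN ray: the middle isolated turn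
  `τ = (τ1, w.2)` has `τ1 ≥ w.1` (east chain of the first turn), so NO plaquette strictly between the extreme rows and west of the root column uses
  its `W` side (its west chain would end at a second middle turn); hence the last plaquette `c = (r.1, r.2 − 1)` is entered from `S`, the south chain of
  `c` is a straight singly visited column down to a bottom-row turn `B = (r.1, Y')` entered from `W` (a third bottom-row turn otherwise), and no arc
  after the first hit of `r` lies east of column `r.1` (the last such arc would re-enter that column from the east). So the excursion never meets the
  eastern ray behind the root mid-edge and the winding functional `A_J` vanishes (#838 parity law, `rayCountAt (holeFaceW w) E = 0`) — against woundness.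
* ★★★ `ΩG.not_bottom_row_of_cost_five_west` (row reflection) and ★★★★ `ΩG.rootCol_le_of_cost_five`: **a wound class-`B2a` walk of limit cost `5`
  returns to a rhombus of the root column or EAST of it** (`w.1 ≤ r.1`): strictly between the extreme rows `r` would be (or its west chain would end
  at) the middle turn, which lies east.
* ★★★★ `ΩG.rootRow_of_cost_five_colfree` (`r.2 = w.2 ∧ w.1 ≤ r.1` with no position hypothesis) and the ROOT-ROW LAW for every rooted rhombus carrying
  a wound cost-`5` class-`B2a` walk (`vertexFunctional_printed_zero_set_finite_of_wound_cost_five'`, `…exists_ne_zero…'`).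

[GlazmanManolescu2019 §1 Fig. 1, eq. (1), Lemma 2.1, Remark 2.2; Glazman2015WeightedSAW Lemma 3.1 (proof, pp. 6–7); CourantRobbins1958 Ch. V App. §2]
-/

noncomputable section

namespace Literature.Probability.RandomPlanarGeometry.SAW.YangBaxter

open Real
open Literature.Barriers.CriticalPhenomena.PlaquetteWalk

open private fc_fh fh_add_Mv three_le_Mv from Literature.Probability.RandomPlanarGeometry.YangBaxterSAWGeneralDomain

namespace ΩG

variable {D : Set Face} {w r : Face} {ω : ΩG D (w.side .W) r}

/-- A side mid-edge on the eastern ray of the hole belongs to a plaquette of the root column or east of it. [cite: CourantRobbins1958, Ch. V Appendix §2 (the even–odd rule: the ray)] -/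
private theorem le_fst_of_eastRayB_side {w f : Face} {s : Side} (h : eastRayB w (f.side s) = true) : w.1 ≤ f.1 := by
  obtain ⟨x, y⟩ := f
  cases s <;> simp [Face.side, eastRayB] at h ⊢ <;> omega

/-! ## No return to the top row west of the root column -/

/-- ★★★ **NO RETURN TO THE TOP ROW AT LIMIT COST `5`, WEST OF THE ROOT COLUMN.** A wound class-`B2a` walk of limit cost `5` from the hole root `w.side W`
(hole absent) at a rhombus `r` with `r.1 < w.1` does not have `r` in its topmost row. [cite: GlazmanManolescu2019, §1, Fig. 1 and eq. (1); Lemma 2.1; Remark 2.2]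
[cite: Glazman2015WeightedSAW, Lemma 3.1 (proof, pp. 6–7)] [cite: CourantRobbins1958, Ch. V Appendix §2 (the even–odd rule)] -/
theorem not_top_row_of_cost_five_west (hh : holeFaceW w ∉ D) (hr : RootedFace D (w.side .W) r) (h : ω.IsB2a)
    (hA : ω.AJ hr h (toC (midPt (w.side .W))) ≠ 0) (hc : cost (slotOfSide ω.1) ω.2.mids = 5) (hwest : r.1 < w.1)
    (htop : ∀ j < ω.2.arcs.length, (ω.2.fc j).2 ≤ r.2) : False := by
  classical
  set n := ω.2.arcs.length with hn
  ---------------------------------------------------------------- basics (as in `not_top_row_of_cost_five`)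
  have hz := end_slanted_of_cost_five hh hr h hA hc
  have hd : slotDeg (slotOfSide ω.1) = 1 := by rcases hz with e | e <;> rw [e] <;> rfl
  have hF := ω.fh_lt h
  have hlen : 0 < n := by omega
  have h0w : ω.2.fc 0 = w := fc_zero_eq_root w hh ω.2 hlen
  have h0W : ω.2.sIn 0 = .W := YBWalk.sIn_zero_eq_W hh ω.2 hlen
  have h0E : ω.2.sIn 0 ≠ .E := by rw [h0W]; decide
  have h0N : ω.2.sIn 0 ≠ .N := by rw [h0W]; decide
  have h0S : ω.2.sIn 0 ≠ .S := by rw [h0W]; decide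
  have hlast := sOut_last_NS_of_slanted h hz
  have hzE : ω.2.sOut (n - 1) ≠ .E := by rcases hlast with e | e <;> rw [e] <;> decide
  have hzW : ω.2.sOut (n - 1) ≠ .W := by rcases hlast with e | e <;> rw [e] <;> decide
  have hlastr := fc_last_ne_root hr h
  have hfcF := (fc_fh ω hr h).1
  have hsvr : ∀ l < n, ω.2.fc l = ω.2.fc ω.2.firstHitG → l = ω.2.firstHitG := fun l hl e => eq_firstHitG_of_fc_eq hr h hl e
  have hfne3 : ω.2.firstHitG + 3 ≤ n := by have := three_le_Mv hr h; have := fh_add_Mv h; unfold ΩG.Mv at *; omega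
  have hzside : (ω.2.fc (n - 1)).side (ω.2.sOut (n - 1)) = r.side ω.1 := by
    obtain ⟨-, hout⟩ := ω.2.side_sIn_eq_nth (show n - 1 < n by omega)
    rwa [show n - 1 + 1 = n by omega, ω.2.nth_length] at hout
  -- profile
  obtain ⟨Y₀, Y', hY'w, hY₀w, hY₀, hY', hprof, T₀, -, hT₀, -, hT₀row, -, hT₀card, -⟩ := turn_profile_of_cost_five hh hr h hA hc
  have hYr : Y₀ = r.2 := by
    obtain ⟨f, hf⟩ : T₀.Nonempty := by rw [← Finset.card_pos, hT₀card]; omega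
    obtain ⟨m, hm, hfm⟩ := ω.2.exists_fc_eq_of_mem_facesL (hT₀ f hf).1
    have h1 := htop m hm; rw [hfm, hT₀row f hf] at h1
    have h2 := hY₀ _ hF; rw [hfcF] at h2
    omega
  subst hYr
  have hY : ∀ j < n, (ω.2.fc j).2 ≤ r.2 := htop
  have hYw : w.2 < r.2 := hY₀w
  let P : Face → Prop := fun f => f ∈ facesL ω.2.mids ∧ (kindsL ω.2.mids f = [.corner] ∨ kindsL ω.2.mids f = [.coCorner])
  have hPiso : ∀ k < n, (∀ l < n, ω.2.fc l = ω.2.fc k → l = k) → arcKind (ω.2.sIn k) (ω.2.sOut k) ≠ .straight → P (ω.2.fc k) :=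
    fun k hk hsv hkind => isolated_turn hk hsv hkind
  have hmid1 : ∀ f g, P f → P g → Y' < f.2 → f.2 < r.2 → Y' < g.2 → g.2 < r.2 → f = g := by
    intro f g hf hg h1 h2 h3 h4
    by_contra hne
    have := (hprof {f, g} (fun x hx => by
      simp only [Finset.mem_insert, Finset.mem_singleton] at hx
      rcases hx with rfl | rfl
      · exact hf
      · exact hg)).2.2 (fun x hx => by
      simp only [Finset.mem_insert, Finset.mem_singleton] at hx
      rcases hx with rfl | rfl
      · exact ⟨h1, h2⟩
      · exact ⟨h3, h4⟩)
    rw [Finset.card_insert_of_notMem (by simpa using hne), Finset.card_singleton, hd] at this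
    omega
  have hrow3 : ∀ f g k : Face, P f → P g → P k → f ≠ g → f ≠ k → g ≠ k →
      ¬(f.2 = r.2 ∧ g.2 = r.2 ∧ k.2 = r.2) ∧ ¬(f.2 = Y' ∧ g.2 = Y' ∧ k.2 = Y') := by
    intro f g k hf hg hk h1 h2 h3
    have hT : ∀ x ∈ ({f, g, k} : Finset Face), P x := by
      intro x hx; simp only [Finset.mem_insert, Finset.mem_singleton] at hx
      rcases hx with rfl | rfl | rfl
      · exact hf
      · exact hg
      · exact hk
    have hcard : ({f, g, k} : Finset Face).card = 3 := by
      rw [Finset.card_insert_of_notMem (by simp [h1, h2]), Finset.card_insert_of_notMem (by simp [h3]), Finset.card_singleton]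
    constructor
    · rintro ⟨e1, e2, e3⟩
      have := (hprof {f, g, k} hT).1 (fun x hx => by
        simp only [Finset.mem_insert, Finset.mem_singleton] at hx
        rcases hx with rfl | rfl | rfl <;> assumption)
      omega
    · rintro ⟨e1, e2, e3⟩
      have := (hprof {f, g, k} hT).2.1 (fun x hx => by
        simp only [Finset.mem_insert, Finset.mem_singleton] at hx
        rcases hx with rfl | rfl | rfl <;> assumption)
      omega
  have hNtop := forall_top_ne_N hh hr h hY hYw
  have hSbot := forall_bottom_ne_S hh hr h hY' hY'w
  obtain ⟨X', -, hX', -⟩ := exists_right_entry_turn hh hr h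
  ---------------------------------------------------------------- the end: `ω.1 = S`, last plaquette `c = (r.1, r.2 − 1)` left through `N`
  have hrside : ∀ s, ω.2.UsesSide r s → r.side s ≠ r.side ω.1 := by
    rintro s ⟨l, hl, hfl, hs⟩ e
    have hl' := hsvr l hl (hfl.trans hfcF.symm)
    obtain ⟨hin, hout⟩ := ω.2.side_sIn_eq_nth hl
    rw [hfl] at hin hout
    rw [← ω.2.nth_length] at e
    rcases hs with hs | hs
    · rw [hs] at hin; have := ω.2.nth_inj (show l ≤ n by omega) le_rfl (hin.symm.trans e).symm.symm; omega
    · rw [hs] at hout; have := ω.2.nth_inj (show l + 1 ≤ n by omega) le_rfl (hout.symm.trans e).symm.symm; omega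
  obtain ⟨hωS, hsN, hc1⟩ : ω.1 = .S ∧ ω.2.sOut (n - 1) = .N ∧ ω.2.fc (n - 1) = (r.1, r.2 - 1) := by
    rcases hfc : ω.2.fc (n - 1) with ⟨x, y⟩
    rw [hfc] at hzside hlastr
    have hyY : y ≤ r.2 := by have := hY (n - 1) (by omega); rw [hfc] at this; exact this
    rcases r with ⟨r1, r2⟩
    simp only at hyY hlastr ⊢
    generalize hs : ω.2.sOut (n - 1) = s at hzside hlast ⊢
    generalize ht : ω.1 = t at hzside hz ⊢
    rcases hz with rfl | rfl <;> rcases hlast with rfl | rfl <;>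
      simp only [Face.side, MidEdge.slant.injEq, Prod.mk.injEq, reduceCtorEq, false_and, and_false, true_and] at hzside ⊢
    · exact absurd (Prod.ext hzside.1 (by simp only; omega)) hlastr
    · omega
    · refine ⟨?_, ?_⟩ <;> omega
    · exact absurd (Prod.ext hzside.1 (by simp only; omega)) hlastr
  ---------------------------------------------------------------- the arc of `r`: straight horizontal (a turn would use `S`, the end side)
  have hNr := hNtop _ hF (by rw [hfcF])
  have hrEW : ω.2.UsesSide r .E ∧ ω.2.UsesSide r .W := by
    have hne := ω.2.sIn_ne_sOut hF
    have hnoS : ¬(ω.2.sIn ω.2.firstHitG = .S ∨ ω.2.sOut ω.2.firstHitG = .S) := by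
      intro hs
      exact hrside .S ⟨_, hF, hfcF, hs⟩ (by rw [hωS])
    have key : (ω.2.sIn ω.2.firstHitG = .E ∧ ω.2.sOut ω.2.firstHitG = .W) ∨ (ω.2.sIn ω.2.firstHitG = .W ∧ ω.2.sOut ω.2.firstHitG = .E) := by
      revert hne hnoS hNr
      cases ω.2.sIn ω.2.firstHitG <;> cases ω.2.sOut ω.2.firstHitG <;> decide
    refine ⟨?_, ?_⟩
    · rcases key with ⟨e, -⟩ | ⟨-, e⟩
      · exact ⟨_, hF, hfcF, Or.inl e⟩
      · exact ⟨_, hF, hfcF, Or.inr e⟩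
    · rcases key with ⟨-, e⟩ | ⟨e, -⟩
      · exact ⟨_, hF, hfcF, Or.inr e⟩
      · exact ⟨_, hF, hfcF, Or.inl e⟩
  obtain ⟨hrE, hrW⟩ := hrEW
  ---------------------------------------------------------------- the top-row turns `T₁ = (r.1 − M₁, r.2)` (uses `E`), `T₂ = (r.1 + M₂, r.2)` (uses `W`)
  obtain ⟨X, hXw, hX, sL, -, hsL, hcolL, -, hinL, houtL⟩ := exists_left_entry_turn hh hr h hA
  have hsvσ : ∀ l < n, ω.2.fc l = ω.2.fc sL → l = sL :=
    fun l hl e => (left_single_visit hh hr h hX (by omega) hsL hl hcolL e.symm).symm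
  have hPσ : P (ω.2.fc sL) := hPiso sL hsL hsvσ (by rw [hinL]; rcases houtL with e | e <;> rw [e] <;> decide)
  obtain ⟨M₁, hE₁, hW₁, hend₁⟩ := ω.2.chain_W hX hrW
  obtain ⟨hM₁1, hnotW₁⟩ : 1 ≤ M₁ ∧ ¬ω.2.UsesSide (r.1 - M₁, r.2) .W := by
    rcases hend₁ with hT | ⟨hA0, -⟩ | ⟨-, hsZ⟩
    · exact hT
    · exfalso; rw [h0w] at hA0; have := congrArg Prod.snd hA0; simp only at this; omega
    · exact absurd hsZ hzW
  obtain ⟨iT₁, hiT₁, hfcT₁, hsvT₁, hET₁, hninT₁, hnoutT₁, hkT₁⟩ := ω.2.isolated_of_usesSide_not_opp (hE₁ M₁ hM₁1 le_rfl) hnotW₁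
  have hPT₁ : P (r.1 - M₁, r.2) := by rw [← hfcT₁]; exact hPiso iT₁ hiT₁ hsvT₁ hkT₁
  obtain ⟨M₂, hW₂, hE₂, hend₂⟩ := ω.2.chain_E hX' hrE
  obtain ⟨hM₂1, hnotE₂⟩ : 1 ≤ M₂ ∧ ¬ω.2.UsesSide (r.1 + M₂, r.2) .E := by
    rcases hend₂ with hT | ⟨-, hs0⟩ | ⟨-, hsZ⟩
    · exact hT
    · exact absurd hs0 h0E
    · exact absurd hsZ hzE
  obtain ⟨iT₂, hiT₂, hfcT₂, hsvT₂, hWT₂, hninT₂, hnoutT₂, hkT₂⟩ := ω.2.isolated_of_usesSide_not_opp (hW₂ M₂ hM₂1 le_rfl) hnotE₂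
  have hPT₂ : P (r.1 + M₂, r.2) := by rw [← hfcT₂]; exact hPiso iT₂ hiT₂ hsvT₂ hkT₂
  -- every top-row isolated turn is `T₁` or `T₂`
  have hrowY : ∀ f, P f → f.2 = r.2 → f = (r.1 - (M₁ : ℤ), r.2) ∨ f = (r.1 + (M₂ : ℤ), r.2) := by
    intro f hf hf2
    by_contra hno
    push Not at hno
    exact (hrow3 _ _ _ hPT₁ hPT₂ hf (by intro e; have := congrArg Prod.fst e; simp only at this; omega) (Ne.symm hno.1) (Ne.symm hno.2)).1
      ⟨rfl, rfl, hf2⟩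
  -- `T₁` uses `S` (a top-row turn through `E`, not `W`, not `N`)
  have hT₁S : ω.2.UsesSide (r.1 - M₁, r.2) .S := by
    have hne := ω.2.sIn_ne_sOut hiT₁
    obtain ⟨hn1, hn2⟩ := hNtop iT₁ hiT₁ (by rw [hfcT₁])
    have key : ω.2.sIn iT₁ = .S ∨ ω.2.sOut iT₁ = .S := by
      revert hET₁ hninT₁ hnoutT₁ hne hn1 hn2 hkT₁
      cases ω.2.sIn iT₁ <;> cases ω.2.sOut iT₁ <;> decide
    exact ⟨iT₁, hiT₁, hfcT₁, key⟩
  have hXT₁ : X ≤ r.1 - M₁ := by have := hX iT₁ hiT₁; rw [hfcT₁] at this; exact this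
  ---------------------------------------------------------------- the first turn and the middle turn `τ = (τ1, w.2)`, with `τ1 ≥ w.1`
  obtain ⟨k₁, hk₁, hstr, hturn⟩ := exists_first_turn_of_wound hh hr h hA hc
  obtain ⟨hrun, -⟩ := ω.2.initial_run hh hk₁ hstr
  obtain ⟨hfk, hWk⟩ := hrun k₁ le_rfl
  have hp₁W : ω.2.UsesSide (w.1 + k₁, w.2) .W := ⟨k₁, hk₁, hfk, Or.inl hWk⟩
  obtain ⟨τ1, hPτ, hτ1w⟩ : ∃ τ1 : ℤ, P (τ1, w.2) ∧ w.1 + k₁ ≤ τ1 := by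
    by_cases hpE : ω.2.UsesSide (w.1 + k₁, w.2) .E
    · obtain ⟨M, hWall, -, hend⟩ := ω.2.chain_E hX' hpE
      rcases hend with ⟨hM1, hnot⟩ | ⟨-, hs0⟩ | ⟨-, hsZ⟩
      · obtain ⟨i', hi', hfc', hsv', -, -, -, hk'⟩ := ω.2.isolated_of_usesSide_not_opp (hWall M hM1 le_rfl) hnot
        refine ⟨w.1 + k₁ + M, ?_, by omega⟩
        have := hPiso i' hi' hsv' hk'; rw [hfc'] at this; exact this
      · exact absurd hs0 h0E
      · exact absurd hsZ hzE
    · obtain ⟨i', hi', hfc', hsv', -, -, -, hk'⟩ := ω.2.isolated_of_usesSide_not_opp hp₁W hpE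
      refine ⟨w.1 + k₁, ?_, le_rfl⟩
      have := hPiso i' hi' hsv' hk'; rw [hfc'] at this; exact this
  -- every middle isolated turn is `τ`; hence it lies in the root column or east of it
  have hmidτ : ∀ f, P f → Y' < f.2 → f.2 < r.2 → f = (τ1, w.2) := fun f hf h1 h2 => hmid1 _ _ hf hPτ h1 h2 hY'w hYw
  have hPmid : ∀ f, P f → Y' < f.2 → f.2 < r.2 → w.1 ≤ f.1 := by
    intro f hf h1 h2
    have := congrArg Prod.fst (hmidτ f hf h1 h2); simp only at this; omega
  ---------------------------------------------------------------- ★ no plaquette strictly between the extreme rows and west of the root column uses `W`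
  have hWmid : ∀ c : Face, Y' < c.2 → c.2 < r.2 → c.1 < w.1 → ¬ω.2.UsesSide c .W := by
    intro c h1 h2 h3 hcW
    obtain ⟨M, hEall, -, hend⟩ := ω.2.chain_W hX hcW
    rcases hend with ⟨hM1, hnot⟩ | ⟨hA0, -⟩ | ⟨-, hsZ⟩
    · obtain ⟨i', hi', hfc', hsv', -, -, -, hk'⟩ := ω.2.isolated_of_usesSide_not_opp (hEall M hM1 le_rfl) hnot
      have hP' : P (c.1 - M, c.2) := by rw [← hfc']; exact hPiso i' hi' hsv' hk'
      have := hPmid _ hP' h1 h2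
      simp only at this; omega
    · rw [h0w] at hA0; have := congrArg Prod.fst hA0; simp only at this; omega
    · exact absurd hsZ hzW
  have hsvmid : ∀ i < n, Y' < (ω.2.fc i).2 → (ω.2.fc i).2 < r.2 → (ω.2.fc i).1 < w.1 → ∀ j < n, ω.2.fc j = ω.2.fc i → j = i := by
    intro i hi h1 h2 h3 j hj he
    by_contra hne
    exact hWmid _ h1 h2 h3 (ω.2.usesSide_of_fc_eq hi hj (Ne.symm hne) he.symm .W)
  ---------------------------------------------------------------- the last plaquette `c` is entered from `S`
  have hn1 : n - 1 < n := by omega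
  have hcS : ω.2.sIn (n - 1) = .S := by
    have hne := ω.2.sIn_ne_sOut hn1
    by_contra hnS
    have hkind : arcKind (ω.2.sIn (n - 1)) (ω.2.sOut (n - 1)) ≠ .straight := by
      revert hne hnS; rw [hsN]; cases ω.2.sIn (n - 1) <;> decide
    have hsv := hsvmid (n - 1) hn1 (by rw [hc1]; simp only; omega) (by rw [hc1]; simp only; omega) (by rw [hc1]; exact hwest)
    have hP := hPiso (n - 1) hn1 hsv hkind
    rw [hc1] at hP
    have := hPmid _ hP (by simp only; omega) (by simp only; omega)
    simp only at this; omega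
  have hcSuse : ω.2.UsesSide (r.1, r.2 - 1) .S := ⟨n - 1, hn1, hc1, Or.inl hcS⟩
  ---------------------------------------------------------------- the south chain of `c`: a straight column down to the bottom-row turn `B = (r.1, Y')`
  obtain ⟨Mc, hNc, hSc, hendc⟩ := ω.2.chain_S hY' hcSuse
  obtain ⟨hMc, hBN, hBnS⟩ : (Mc : ℤ) = r.2 - 1 - Y' ∧ ω.2.UsesSide (r.1, Y') .N ∧ ¬ω.2.UsesSide (r.1, Y') .S := by
    rcases hendc with ⟨hM1, hnot⟩ | ⟨-, hs0⟩ | ⟨-, hsZ⟩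
    · obtain ⟨i', hi', hfc', hsv', -, -, -, hk'⟩ := ω.2.isolated_of_usesSide_not_opp (hNc Mc hM1 le_rfl) hnot
      have hP' : P (r.1, r.2 - 1 - Mc) := by rw [← hfc']; exact hPiso i' hi' hsv' hk'
      have hge : Y' ≤ r.2 - 1 - Mc := by have := hY' i' hi'; rw [hfc'] at this; exact this
      rcases lt_or_eq_of_le hge with hlt | heq
      · have := hPmid _ hP' hlt (by simp only; omega)
        simp only at this; omega
      · have eY : r.2 - 1 - (Mc : ℤ) = Y' := heq.symm
        simp only at hnot
        refine ⟨by omega, ?_, ?_⟩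
        · have := hNc Mc hM1 le_rfl; simp only at this; rwa [eY] at this
        · rwa [eY] at hnot
    · exact absurd hs0 h0S
    · rw [hsN] at hsZ; exact absurd hsZ (by decide)
  obtain ⟨iB, hiB, hfcB, hsvB, hNB, hninB, hnoutB, hkB⟩ := ω.2.isolated_of_usesSide_not_opp hBN hBnS
  have hPB : P (r.1, Y') := by rw [← hfcB]; exact hPiso iB hiB hsvB hkB
  -- the cells of column `r.1` strictly between `B` and `r` use `N` and `S`, are singly visited, hence are not entered from `E`
  have hcolNS : ∀ y : ℤ, Y' < y → y < r.2 → ω.2.UsesSide (r.1, y) .N ∧ ω.2.UsesSide (r.1, y) .S := by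
    intro y h1 h2
    obtain ⟨m, hm⟩ : ∃ m : ℕ, (m : ℤ) = r.2 - 1 - y := ⟨(r.2 - 1 - y).toNat, by omega⟩
    have ey : ((r.1, r.2 - 1) : Face) = (r.1, r.2 - 1) := rfl
    have hmM : m < Mc := by omega
    have eS := hSc m hmM
    simp only at eS
    rw [show r.2 - 1 - (m : ℤ) = y by omega] at eS
    refine ⟨?_, eS⟩
    rcases Nat.eq_zero_or_pos m with hm0 | hmpos
    · rw [hm0] at hm
      rw [show y = r.2 - 1 by omega]
      exact ⟨n - 1, hn1, hc1, Or.inr hsN⟩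
    · have eN := hNc m hmpos hmM.le
      simp only at eN
      rwa [show r.2 - 1 - (m : ℤ) = y by omega] at eN
  have hcolE : ∀ i < n, (ω.2.fc i).1 = r.1 → Y' < (ω.2.fc i).2 → (ω.2.fc i).2 < r.2 → ω.2.sIn i ≠ .E := by
    intro i hi hc h1 h2 hE
    have hsv := hsvmid i hi h1 h2 (by rw [hc]; exact hwest)
    obtain ⟨hN, hS⟩ := hcolNS (ω.2.fc i).2 h1 h2
    rw [← hc] at hN hS
    obtain ⟨j, hj, hfj, hjN⟩ := hN
    obtain ⟨k, hk, hfk', hkS⟩ := hS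
    rw [hsv j hj hfj] at hjN
    rw [hsv k hk hfk'] at hkS
    have hne := ω.2.sIn_ne_sOut hi
    revert hjN hkS hne hE
    cases ω.2.sIn i <;> cases ω.2.sOut i <;> decide
  ---------------------------------------------------------------- the bottom-left turn `B₁ = (X, Y')`: the left entry turn `σ` (column `X`) or below `T₁`
  have hσrow : (ω.2.fc sL).2 = r.2 ∨ (ω.2.fc sL).2 = Y' := by
    have h1 := hY sL hsL; have h2 := hY' sL hsL
    by_contra hno
    push Not at hno
    have := hPmid _ hPσ (lt_of_le_of_ne h2 (fun e => hno.2 e.symm)) (lt_of_le_of_ne h1 hno.1)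
    rw [hcolL] at this; omega
  have hPB₁ : P (X, Y') := by
    rcases hσrow with hσY | hσY'
    · -- `σ` in the top row is `T₁`; the south chain of `T₁` descends to `(X, Y')`
      have hT₁X : r.1 - (M₁ : ℤ) = X := by
        rcases hrowY _ hPσ hσY with e | e
        · have := congrArg Prod.fst e; rw [hcolL] at this; simp only at this; omega
        · have := congrArg Prod.fst e; rw [hcolL] at this; simp only at this; omega
      obtain ⟨Md₁, hNd₁, -, hendd₁⟩ := ω.2.chain_S hY' hT₁S
      rcases hendd₁ with ⟨hM1, hnot⟩ | ⟨-, hs0⟩ | ⟨-, hsZ⟩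
      · obtain ⟨i', hi', hfc', hsv', -, -, -, hk'⟩ := ω.2.isolated_of_usesSide_not_opp (hNd₁ Md₁ hM1 le_rfl) hnot
        have hP' : P (r.1 - M₁, r.2 - Md₁) := by rw [← hfc']; exact hPiso i' hi' hsv' hk'
        have hge : Y' ≤ r.2 - Md₁ := by have := hY' i' hi'; rw [hfc'] at this; exact this
        rcases lt_or_eq_of_le hge with hlt | heq
        · have := hPmid _ hP' hlt (by simp only; omega)
          simp only at this; omega
        · have eY : r.2 - (Md₁ : ℤ) = Y' := heq.symm
          rwa [eY, hT₁X] at hP'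
      · exact absurd hs0 h0S
      · rw [hsN] at hsZ; exact absurd hsZ (by decide)
    · rw [← hcolL, ← hσY']; exact hPσ
  have hXr : X < r.1 := by omega
  ---------------------------------------------------------------- `B` is entered from `W` (not from `E`: a third bottom-row turn at the east end of its chain)
  have hBE : ω.2.sIn iB ≠ .E := by
    intro hE
    obtain ⟨M, hWall, -, hend⟩ := ω.2.chain_E hX' ⟨iB, hiB, hfcB, Or.inl hE⟩
    rcases hend with ⟨hM1, hnot⟩ | ⟨-, hs0⟩ | ⟨-, hsZ⟩
    · obtain ⟨i', hi', hfc', hsv', -, -, -, hk'⟩ := ω.2.isolated_of_usesSide_not_opp (hWall M hM1 le_rfl) hnot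
      have hP' : P (r.1 + M, Y') := by rw [← hfc']; exact hPiso i' hi' hsv' hk'
      exact (hrow3 _ _ _ hPB₁ hPB hP' (by intro e; have := congrArg Prod.fst e; simp only at this; omega)
        (by intro e; have := congrArg Prod.fst e; simp only at this; omega)
        (by intro e; have := congrArg Prod.fst e; simp only at this; omega)).2 ⟨rfl, rfl, rfl⟩
    · exact absurd hs0 h0E
    · exact absurd hsZ hzE
  ---------------------------------------------------------------- ★ no arc after the first hit of `r` lies east of column `r.1`
  have hJwest : ∀ i, ω.2.firstHitG ≤ i → i < n → (ω.2.fc i).1 ≤ r.1 := by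
    by_contra hno
    push Not at hno
    -- the LAST arc east of column `r.1`
    have hex : ∃ m, ∃ i, i + m + 1 = n ∧ ω.2.firstHitG ≤ i ∧ r.1 < (ω.2.fc i).1 := by
      obtain ⟨i, hFi, hi, hci⟩ := hno
      exact ⟨n - 1 - i, i, by omega, hFi, hci⟩
    obtain ⟨i₁, hi₁n, hFi₁, hci₁⟩ := Nat.find_spec hex
    have hmin : ∀ m < Nat.find hex, ¬∃ i, i + m + 1 = n ∧ ω.2.firstHitG ≤ i ∧ r.1 < (ω.2.fc i).1 := fun m hm => Nat.find_min hex hm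
    set m₁ := Nat.find hex with hm₁
    -- not the last arc (the last plaquette lies in column `r.1`)
    have hm₁pos : 0 < m₁ := by
      by_contra h0
      have e : i₁ = n - 1 := by omega
      rw [e, hc1] at hci₁; simp only at hci₁; omega
    have hi₁1 : i₁ + 1 < n := by omega
    have hnext : (ω.2.fc (i₁ + 1)).1 ≤ r.1 := by
      by_contra hgt
      push Not at hgt
      exact hmin (m₁ - 1) (by omega) ⟨i₁ + 1, by omega, by omega, hgt⟩
    -- the arc `i₁` leaves through `W` into column `r.1`, entering from `E`
    have hWi₁ : ω.2.sOut i₁ = .W := by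
      have hne := ω.2.sIn_ne_sOut (show i₁ < n by omega)
      rcases hso : ω.2.sOut i₁ with _ | _ | _ | _
      · rfl
      · have := (ω.2.fc_succ_eq_of_sOut_E hi₁1 hso).1
        have := congrArg Prod.fst this; simp only at this; omega
      · have := ω.2.fc_succ_eq_of_sOut_S hi₁1 hso
        have := congrArg Prod.fst this; simp only at this; omega
      · have := ω.2.fc_succ_eq_of_sOut_N hi₁1 hso
        have := congrArg Prod.fst this; simp only at this; omega
    obtain ⟨hfc₂, hin₂⟩ := ω.2.fc_succ_eq_of_sOut_W hi₁1 hWi₁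
    have hcol₂ : (ω.2.fc (i₁ + 1)).1 = r.1 := by
      have := congrArg Prod.fst hfc₂; simp only at this; omega
    have hrow₂ := hY (i₁ + 1) hi₁1
    rcases lt_or_eq_of_le hrow₂ with hlt | heq
    · refine hcolE (i₁ + 1) hi₁1 hcol₂ (lt_of_le_of_ne (hY' _ hi₁1) (fun e => ?_)) hlt hin₂
      -- in the bottom row: the plaquette is `B`, entered from `W`
      have hfB : ω.2.fc (i₁ + 1) = (r.1, Y') := Prod.ext hcol₂ e.symm
      have := hsvB (i₁ + 1) hi₁1 (hfB.trans hfcB.symm)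
      rw [this] at hin₂
      exact hBE hin₂
    · -- in the top row: the plaquette is `r`, at the first hit
      have hfr : ω.2.fc (i₁ + 1) = r := Prod.ext hcol₂ heq
      have := hsvr (i₁ + 1) hi₁1 (hfr.trans hfcF.symm)
      omega
  ---------------------------------------------------------------- the excursion never meets the eastern ray: `A_J = 0`
  have hray : ω.rayCountAt hr h (holeFaceW w) .E = 0 := by
    rw [rayCountAt_holeFaceW_E_eq_card_root ω hr h, Finset.card_eq_zero, Finset.filter_eq_empty_iff]
    intro j hj htrue
    rw [Finset.mem_range] at hj
    have hMv : ω.2.firstHitG + ω.Mv = n := fh_add_Mv h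
    by_cases hjn : ω.2.firstHitG + j + 1 < n
    · obtain ⟨hin, -⟩ := ω.2.side_sIn_eq_nth hjn
      rw [← hin] at htrue
      have h1 := le_fst_of_eastRayB_side htrue
      have h2 := hJwest (ω.2.firstHitG + j + 1) (by omega) hjn
      omega
    · have e : ω.2.firstHitG + j + 1 = n := by omega
      rw [e, ω.2.nth_length] at htrue
      have := le_fst_of_eastRayB_side htrue
      omega
  have hodd := (ω.AJ_root_ne_zero_iff_odd_rayCountAt (hr := hr) h (holeFaceW_side_E w)).1 hA
  rw [hray] at hodd
  exact absurd hodd (by decide)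

/-! ## The bottom row, by reflection -/

/-- ★★★ **NO RETURN TO THE BOTTOM ROW AT LIMIT COST `5`, WEST OF THE ROOT COLUMN** — the row reflection of `not_top_row_of_cost_five_west`.
[cite: GlazmanManolescu2019, §1, Fig. 1 and eq. (1); Lemma 2.1; §4.2 (lattice symmetries)] [cite: Glazman2015WeightedSAW, Lemma 3.1 (proof, pp. 6–7)]
[cite: CourantRobbins1958, Ch. V Appendix §2 (the even–odd rule)] -/
theorem not_bottom_row_of_cost_five_west (hh : holeFaceW w ∉ D) (hr : RootedFace D (w.side .W) r) (h : ω.IsB2a)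
    (hA : ω.AJ hr h (toC (midPt (w.side .W))) ≠ 0) (hc : cost (slotOfSide ω.1) ω.2.mids = 5) (hwest : r.1 < w.1)
    (hbot : ∀ j < ω.2.arcs.length, r.2 ≤ (ω.2.fc j).2) : False := by
  have hh' : holeFaceW w ∉ rowMirrorDom w D := by
    rw [mem_rowMirrorDom]
    have e : mirrorRowFace w.2 (holeFaceW w) = holeFaceW w := by
      simp only [mirrorRowFace, holeFaceW]; exact Prod.ext rfl (by simp only; ring)
    rw [e]; exact hh
  have hr' := rootedFace_rowMirrorDom_mirrorRowFace (w := w) hr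
  have h' := isB2a_mirrorAt hr h
  have hA' := AJ_mirrorAt_ne_zero hr h hA
  have hc' : cost (slotOfSide ω.mirrorAt.1) ω.mirrorAt.2.mids = 5 := by
    show cost (slotOfSide (mirrorSide ω.1)) (ω.2.mids.map (mirrorRow w.2)) = 5
    rw [cost_map_mirrorRow]; exact hc
  have hlen : ω.mirrorAt.2.arcs.length = ω.2.arcs.length := YBWalk.length_arcs_eq_of_mids_mirror ω.mirrorAt_mids
  refine not_top_row_of_cost_five_west (ω := ω.mirrorAt) hh' hr' h' hA' hc' hwest ?_
  intro j hj
  rw [hlen] at hj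
  rw [YBWalk.fc_eq_of_mids_mirror ω.mirrorAt_mids hj]
  have := hbot j hj
  simp only [mirrorRowFace]
  omega

/-! ## B2a members live in the root column or east of it -/

/-- ★★★★ **NO LEVEL-`5` CLASS-`B2a` MEMBER WEST OF THE ROOT COLUMN**: a wound class-`B2a` walk of limit cost `5` from the hole root `w.side W`
(hole absent) returns to a rhombus `r` with `w.1 ≤ r.1`. In the extreme rows this is `not_top_row_of_cost_five_west` / `not_bottom_row_of_cost_five_west`;
strictly between them, if the arc of `r` turns, `r` is THE middle isolated turn, which lies at the east end of the first turn's chain (`≥ w.1`); if it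
is straight it is horizontal (the end side of `r` is slanted and unused) and the west chain of `r` ends at the middle turn or at `w`, both east.
[cite: GlazmanManolescu2019, §1, Fig. 1 and eq. (1); Lemma 2.1; Remark 2.2] [cite: Glazman2015WeightedSAW, Lemma 3.1 (proof, pp. 6–7)]
[cite: CourantRobbins1958, Ch. V Appendix §2 (the even–odd rule)] -/
theorem rootCol_le_of_cost_five (hh : holeFaceW w ∉ D) (hr : RootedFace D (w.side .W) r) (h : ω.IsB2a)
    (hA : ω.AJ hr h (toC (midPt (w.side .W))) ≠ 0) (hc : cost (slotOfSide ω.1) ω.2.mids = 5) : w.1 ≤ r.1 := by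
  classical
  by_contra hlt
  push Not at hlt
  set n := ω.2.arcs.length with hn
  have hz := end_slanted_of_cost_five hh hr h hA hc
  have hd : slotDeg (slotOfSide ω.1) = 1 := by rcases hz with e | e <;> rw [e] <;> rfl
  have hF := ω.fh_lt h
  have hlen : 0 < n := by omega
  have h0w : ω.2.fc 0 = w := fc_zero_eq_root w hh ω.2 hlen
  have h0W : ω.2.sIn 0 = .W := YBWalk.sIn_zero_eq_W hh ω.2 hlen
  have h0E : ω.2.sIn 0 ≠ .E := by rw [h0W]; decide
  have hlast := sOut_last_NS_of_slanted h hz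
  have hzE : ω.2.sOut (n - 1) ≠ .E := by rcases hlast with e | e <;> rw [e] <;> decide
  have hzW : ω.2.sOut (n - 1) ≠ .W := by rcases hlast with e | e <;> rw [e] <;> decide
  have hfcF := (fc_fh ω hr h).1
  have hsvr : ∀ l < n, ω.2.fc l = ω.2.fc ω.2.firstHitG → l = ω.2.firstHitG := fun l hl e => eq_firstHitG_of_fc_eq hr h hl e
  have hfne3 : ω.2.firstHitG + 3 ≤ n := by have := three_le_Mv hr h; have := fh_add_Mv h; unfold ΩG.Mv at *; omega
  ---------------------------------------------------------------- the profile; `r` lies strictly between the extreme rows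
  obtain ⟨Y₀, Y', hY'w, hY₀w, hY₀, hY', hprof, -⟩ := turn_profile_of_cost_five hh hr h hA hc
  have hrY₀ : r.2 ≠ Y₀ := fun e => not_top_row_of_cost_five_west hh hr h hA hc hlt (fun j hj => by rw [e]; exact hY₀ j hj)
  have hrY' : r.2 ≠ Y' := fun e => not_bottom_row_of_cost_five_west hh hr h hA hc hlt (fun j hj => by rw [e]; exact hY' j hj)
  have hr₁ : Y' < r.2 := by have := hY' _ hF; rw [hfcF] at this; omega
  have hr₂ : r.2 < Y₀ := by have := hY₀ _ hF; rw [hfcF] at this; omega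
  let P : Face → Prop := fun f => f ∈ facesL ω.2.mids ∧ (kindsL ω.2.mids f = [.corner] ∨ kindsL ω.2.mids f = [.coCorner])
  have hPiso : ∀ k < n, (∀ l < n, ω.2.fc l = ω.2.fc k → l = k) → arcKind (ω.2.sIn k) (ω.2.sOut k) ≠ .straight → P (ω.2.fc k) :=
    fun k hk hsv hkind => isolated_turn hk hsv hkind
  have hmid1 : ∀ f g, P f → P g → Y' < f.2 → f.2 < Y₀ → Y' < g.2 → g.2 < Y₀ → f = g := by
    intro f g hf hg h1 h2 h3 h4
    by_contra hfg
    have := (hprof {f, g} (fun x hx => by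
      simp only [Finset.mem_insert, Finset.mem_singleton] at hx
      rcases hx with rfl | rfl
      · exact hf
      · exact hg)).2.2 (fun x hx => by
      simp only [Finset.mem_insert, Finset.mem_singleton] at hx
      rcases hx with rfl | rfl
      · exact ⟨h1, h2⟩
      · exact ⟨h3, h4⟩)
    rw [Finset.card_insert_of_notMem (by simpa using hfg), Finset.card_singleton, hd] at this
    omega
  obtain ⟨X', -, hX', -⟩ := exists_right_entry_turn hh hr h
  obtain ⟨X, -, hX, -⟩ := exists_left_entry_turn hh hr h hA
  ---------------------------------------------------------------- the middle turn `τ` lies on the root row, in the root column or east of it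
  obtain ⟨k₁, hk₁, hstr, hturn⟩ := exists_first_turn_of_wound hh hr h hA hc
  obtain ⟨hrun, -⟩ := ω.2.initial_run hh hk₁ hstr
  obtain ⟨hfk, hWk⟩ := hrun k₁ le_rfl
  have hp₁W : ω.2.UsesSide (w.1 + k₁, w.2) .W := ⟨k₁, hk₁, hfk, Or.inl hWk⟩
  obtain ⟨τ1, hPτ, hτ1w⟩ : ∃ τ1 : ℤ, P (τ1, w.2) ∧ w.1 + k₁ ≤ τ1 := by
    by_cases hpE : ω.2.UsesSide (w.1 + k₁, w.2) .E
    · obtain ⟨M, hWall, -, hend⟩ := ω.2.chain_E hX' hpE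
      rcases hend with ⟨hM1, hnot⟩ | ⟨-, hs0⟩ | ⟨-, hsZ⟩
      · obtain ⟨i', hi', hfc', hsv', -, -, -, hk'⟩ := ω.2.isolated_of_usesSide_not_opp (hWall M hM1 le_rfl) hnot
        refine ⟨w.1 + k₁ + M, ?_, by omega⟩
        have := hPiso i' hi' hsv' hk'; rw [hfc'] at this; exact this
      · exact absurd hs0 h0E
      · exact absurd hsZ hzE
    · obtain ⟨i', hi', hfc', hsv', -, -, -, hk'⟩ := ω.2.isolated_of_usesSide_not_opp hp₁W hpE
      refine ⟨w.1 + k₁, ?_, le_rfl⟩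
      have := hPiso i' hi' hsv' hk'; rw [hfc'] at this; exact this
  ---------------------------------------------------------------- the arc of `r`
  by_cases hk : arcKind (ω.2.sIn ω.2.firstHitG) (ω.2.sOut ω.2.firstHitG) = .straight
  · -- straight: not vertical (the end side of `r` is `N` or `S` and unused), so `r` uses `W`
    have hrside : ∀ s, ω.2.UsesSide r s → r.side s ≠ r.side ω.1 := by
      rintro s ⟨l, hl, hfl, hs⟩ e
      have hl' := hsvr l hl (hfl.trans hfcF.symm)
      obtain ⟨hin, hout⟩ := ω.2.side_sIn_eq_nth hl
      rw [hfl] at hin hout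
      rw [← ω.2.nth_length] at e
      rcases hs with hs | hs
      · rw [hs] at hin; have := ω.2.nth_inj (show l ≤ n by omega) le_rfl (hin.symm.trans e).symm.symm; omega
      · rw [hs] at hout; have := ω.2.nth_inj (show l + 1 ≤ n by omega) le_rfl (hout.symm.trans e).symm.symm; omega
    have hout := ω.2.sOut_of_straight hF hk
    have hrW : ω.2.UsesSide r .W := by
      have hN : ¬(ω.2.UsesSide r .N ∧ ω.2.UsesSide r .S) := by
        rintro ⟨h1, h2⟩
        rcases hz with e | e
        · exact hrside .N h1 (by rw [e])
        · exact hrside .S h2 (by rw [e])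
      have key : ω.2.sIn ω.2.firstHitG = .W ∨ ω.2.sOut ω.2.firstHitG = .W ∨
          ((ω.2.sIn ω.2.firstHitG = .N ∨ ω.2.sOut ω.2.firstHitG = .N) ∧ (ω.2.sIn ω.2.firstHitG = .S ∨ ω.2.sOut ω.2.firstHitG = .S)) := by
        revert hout; cases ω.2.sIn ω.2.firstHitG <;> cases ω.2.sOut ω.2.firstHitG <;> decide
      rcases key with e | e | ⟨hN', hS'⟩
      · exact ⟨_, hF, hfcF, Or.inl e⟩
      · exact ⟨_, hF, hfcF, Or.inr e⟩
      · exact absurd ⟨⟨_, hF, hfcF, hN'⟩, ⟨_, hF, hfcF, hS'⟩⟩ hN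
    obtain ⟨M, hEall, -, hend⟩ := ω.2.chain_W hX hrW
    rcases hend with ⟨hM1, hnot⟩ | ⟨hA0, -⟩ | ⟨-, hsZ⟩
    · obtain ⟨i', hi', hfc', hsv', -, -, -, hk'⟩ := ω.2.isolated_of_usesSide_not_opp (hEall M hM1 le_rfl) hnot
      have hP' : P (r.1 - M, r.2) := by rw [← hfc']; exact hPiso i' hi' hsv' hk'
      have := hmid1 _ _ hP' hPτ hr₁ hr₂ hY'w hY₀w
      have := congrArg Prod.fst this; simp only at this; omega
    · rw [h0w] at hA0; have := congrArg Prod.fst hA0; simp only at this; omega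
    · exact absurd hsZ hzW
  · -- a turn: `r` is an isolated turn strictly between the extreme rows, hence the middle turn
    have hPr : P r := by have := hPiso _ hF hsvr hk; rwa [hfcF] at this
    have := hmid1 _ _ hPr hPτ hr₁ hr₂ hY'w hY₀w
    have := congrArg Prod.fst this; simp only at this; omega

/-- ★★★★ **B2a MEMBERS LIVE ON THE ROOT ROW, IN THE ROOT COLUMN OR EAST OF IT** — `ΩG.rootRow_of_cost_five` with its position hypothesis discharged by
`rootCol_le_of_cost_five`: a wound class-`B2a` walk of limit cost `5` from the hole root `w.side W` (hole absent) returns to a rhombus `r` with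
`r.2 = w.2` and `w.1 ≤ r.1`. [cite: GlazmanManolescu2019, §1, Fig. 1 and eq. (1); Lemma 2.1; Remark 2.2] [cite: Glazman2015WeightedSAW, Lemma 3.1 (proof, pp. 6–7)]
[cite: CourantRobbins1958, Ch. V Appendix §2 (the even–odd rule)] -/
theorem rootRow_of_cost_five_colfree (hh : holeFaceW w ∉ D) (hr : RootedFace D (w.side .W) r) (h : ω.IsB2a)
    (hA : ω.AJ hr h (toC (midPt (w.side .W))) ≠ 0) (hc : cost (slotOfSide ω.1) ω.2.mids = 5) : r.2 = w.2 ∧ w.1 ≤ r.1 :=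
  have hcol := rootCol_le_of_cost_five hh hr h hA hc
  ⟨rootRow_of_cost_five hh hr h hA hc hcol, hcol⟩

end ΩG

end Literature.Probability.RandomPlanarGeometry.SAW.YangBaxter

namespace Literature.Barriers.CriticalPhenomena.PlaquetteWalk

open Literature.Probability.RandomPlanarGeometry.SAW.YangBaxter
open Real

variable (Dl : List Face)

/-! ## The root-row law at every rhombus carrying a wound cost-`5` class-`B2a` walk -/

open Classical in
/-- ★★★★★ **THE ROOT-ROW LAW, POSITION-FREE.** Let `a = w.side W` be a `W`-normalised hole root of the finite domain `dom Dl` (hole absent) and `f₀` ANY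
rooted rhombus carrying a wound class-`B2a` walk of limit cost `5`. Then `f₀` lies on the root row in the root column or east of it
(`ΩG.rootRow_of_cost_five_colfree`), and the zero set in `θ ∈ (0, π)` of the printed-weight vertex functional at `f₀` is finite, with at most
`4·maxExp − 4` zeros. [cite: GlazmanManolescu2019, §1, eq. (1) and Fig. 1; Lemma 2.1, eq. (CR); Remark 2.2] [cite: Glazman2015WeightedSAW, Lemma 3.1 (proof, pp. 6–7)]
[cite: CourantRobbins1958, Ch. V Appendix §2 (the even–odd rule)] -/
theorem vertexFunctional_printed_zero_set_finite_of_wound_cost_five' {w f₀ : Face} (hh : holeFaceW w ∉ dom Dl)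
    (hr : RootedFace (dom Dl) (w.side .W) f₀)
    (hex : ∃ (ω : ΩG (dom Dl) (w.side .W) f₀) (h : ω.IsB2a), ω.AJ hr h (toC (midPt (w.side .W))) ≠ 0 ∧
      cost (slotOfSide ω.1) ω.2.mids = 5) :
    {θ ∈ Set.Ioo 0 π | vertexFunctional (printedWeights θ) tFiveEighths (ybCoeff θ) Dl (w.side .W) f₀ = 0}.Finite ∧
      {θ ∈ Set.Ioo 0 π | vertexFunctional (printedWeights θ) tFiveEighths (ybCoeff θ) Dl (w.side .W) f₀ = 0}.ncard ≤
        4 * maxExp Dl (w.side .W) f₀ + 1 - 5 := by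
  obtain ⟨ω, h, hA, hc⟩ := hex
  have hcol := ΩG.rootCol_le_of_cost_five hh hr h hA hc
  exact vertexFunctional_printed_zero_set_finite_of_wound_cost_five Dl hh hr hcol ⟨ω, h, hA, hc⟩

/-- ★★★★★ **Hence some `θ ∈ (0, π)` has a NON-VANISHING printed-weight vertex functional at every rooted rhombus carrying a wound cost-`5` class-`B2a` walk,
whatever its position.** [cite: GlazmanManolescu2019, §1, eq. (1); Lemma 2.1, eq. (CR); Remark 2.2] [cite: Glazman2015WeightedSAW, Lemma 3.1 (proof, pp. 6–7)] -/
theorem vertexFunctional_printed_exists_ne_zero_of_wound_cost_five' {w f₀ : Face} (hh : holeFaceW w ∉ dom Dl)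
    (hr : RootedFace (dom Dl) (w.side .W) f₀)
    (hex : ∃ (ω : ΩG (dom Dl) (w.side .W) f₀) (h : ω.IsB2a), ω.AJ hr h (toC (midPt (w.side .W))) ≠ 0 ∧
      cost (slotOfSide ω.1) ω.2.mids = 5) :
    ∃ θ ∈ Set.Ioo 0 π, vertexFunctional (printedWeights θ) tFiveEighths (ybCoeff θ) Dl (w.side .W) f₀ ≠ 0 := by
  obtain ⟨ω, h, hA, hc⟩ := hex
  have hcol := ΩG.rootCol_le_of_cost_five hh hr h hA hc
  exact vertexFunctional_printed_exists_ne_zero_of_wound_cost_five Dl hh hr hcol ⟨ω, h, hA, hc⟩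

end Literature.Barriers.CriticalPhenomena.PlaquetteWalk
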